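import Summits.NavierStokesRegularity.NavierStokesRegularity.Theorems.ExtremiserTransienceNearExtremalTransienceExtremiserLiouvilleConstantSpeedSlideGenerator
import HarnessLib

/-!
# Crux `ExtremiserTransience.NearExtremalTransience` (stmt-NavierStokesRegularity-21883), line `extremiser_liouville`,
# stub K1b — THE BOUNDARY PAIRING OF THE SLIDE: `∫h(x₂)(⟪V_h,∂₂V_h⟫ − ⟪V_h,∇_hV₂⟫) = −½∫h′(x₂)(‖V‖² − 2V₂²)`

`--supports stmt-NavierStokesRegularity-21883` (helper).  Author: prover seat `ns-el-k1b` (g8).  Record: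
`Cruxes/NearExtremalTransience/Lines/extremiser_liouville_k1b_slide.md` §2 (the `g″`-term of identity (A)).

The enstrophy law of the Piola slide (`…ConstantSpeedSlideEnstrophyLaw`) ends with the pairing
`∫g″(x₂)·(⟪V_h,∂₂V_h⟫ − ⟪V_h,∇_hV₂⟫)`, the only term that carries `V` undifferentiated.  Two integrations by parts
(one axial, one horizontal, using `div V = 0`) turn it into a bare weighted energy:
* `integral_axialWeight_inner_fderiv_eq_of_integrable` : the axial rule `∫h(x₂)⟪F,∂₂F⟫ = −½∫h′(x₂)‖F‖²` under SLAB
  integrability only (`h‖F‖², h⟪F,∂₂F⟫, h′‖F‖² ∈ L¹`; no global `L²`), for the jet whose excess energy is only slab-integrable;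
* `integral_axialWeight_fderiv_apply_horizontal_eq` : the horizontal rule `∫h(x₂)·Df(A) = −∫h(x₂)·f·div A` for a horizontal
  field `A` (`A₂ ≡ 0`), e.g. `A = V_h`;
* `integral_slideTail_eq` : **`∫h(x₂)(⟪V_h,∂₂V_h⟫ − ⟪V_h,∇_hV₂⟫) = −½∫h′(x₂)(‖V‖² − 2V₂²)`** for `V ∈ C¹` divergence free with
  `DV ∈ L²`, `‖V‖²` integrable on the slab `{|x₂| ≤ T}` carrying `h` (`h ∈ C¹`, `h, h′` bounded, vanishing for `|s| ≥ T`).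
For the JET (`∫H′(x₂−s)‖V‖² ≡ E₀`) the right-hand side is `∫h′V₂² = ∫h′‖V‖⁴/4M²` — second-order small (record (KIN)).

WHAT THIS IS NOT: K1b is NOT proved; nothing here proves NS regularity. [folklore]
-/

noncomputable section

open Set Filter Topology MeasureTheory Metric Function InnerProductSpace
open scoped ENNReal NNReal Topology InnerProductSpace RealInnerProductSpace ContDiff
open Literature.Analysis.FluidPDE Literature.Analysis

namespace Summit.NavierStokesRegularity.NavierStokesRegularity.Theorems

-- the problem directory repeats the summit name (`NavierStokesRegularity/NavierStokesRegularity`)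
set_option linter.dupNamespace false

namespace ExtremiserLiouville

open DepletionLadder.KStar

variable {V F A : EuclideanSpace ℝ (Fin 3) → EuclideanSpace ℝ (Fin 3)} {f : EuclideanSpace ℝ (Fin 3) → ℝ} {h : ℝ → ℝ}

/-! ## 1. The axial rule under slab integrability -/

/-- **Axial integration by parts, slab-integrable version**: for `F ∈ C¹(ℝ³;ℝ³)`, `h ∈ C¹(ℝ)`, if `h(x₂)‖F‖²`,
`h(x₂)⟪F,∂₂F⟫` and `h′(x₂)‖F‖²` are integrable then `∫ h(x₂)⟪F, ∂₂F⟫ = −½∫ h′(x₂)‖F‖²`. [folklore] -/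
theorem integral_axialWeight_inner_fderiv_eq_of_integrable (hF : ContDiff ℝ 1 F) (hh : ContDiff ℝ 1 h)
    (i0 : Integrable (fun x => h (x 2) * ‖F x‖ ^ 2) volume)
    (i1 : Integrable (fun x => h (x 2) * ⟪F x, fderiv ℝ F x (EuclideanSpace.single (2 : Fin 3) (1 : ℝ))⟫) volume)
    (i2 : Integrable (fun x => deriv h (x 2) * ‖F x‖ ^ 2) volume) :
    (∫ x, h (x 2) * ⟪F x, fderiv ℝ F x (EuclideanSpace.single (2 : Fin 3) (1 : ℝ))⟫) =
      -(1 / 2) * ∫ x, deriv h (x 2) * ‖F x‖ ^ 2 := by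
  set e₂ : EuclideanSpace ℝ (Fin 3) := EuclideanSpace.single (2 : Fin 3) (1 : ℝ) with he₂
  have hFd : Differentiable ℝ F := hF.differentiable one_ne_zero
  have hhd : Differentiable ℝ h := hh.differentiable one_ne_zero
  set a : EuclideanSpace ℝ (Fin 3) → ℝ := fun y => h (y 2) with ha
  set n : EuclideanSpace ℝ (Fin 3) → ℝ := fun y => ‖F y‖ ^ 2 with hn
  have haD : ∀ y, HasFDerivAt a (deriv h (y 2) •
      (EuclideanSpace.proj (2 : Fin 3) : EuclideanSpace ℝ (Fin 3) →L[ℝ] ℝ)) y := fun y => hasFDerivAt_comp_coord hhd 2 y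
  have ha1 : ContDiff ℝ 1 a := by
    have : a = fun y => h ((EuclideanSpace.proj (2 : Fin 3) : EuclideanSpace ℝ (Fin 3) →L[ℝ] ℝ) y) := rfl
    rw [this]; exact hh.comp (EuclideanSpace.proj (2 : Fin 3) : EuclideanSpace ℝ (Fin 3) →L[ℝ] ℝ).contDiff
  have hnD : ∀ y, HasFDerivAt n (2 • (innerSL ℝ (F y)).comp (fderiv ℝ F y)) y := fun y => (hFd y).hasFDerivAt.norm_sq
  have hn1 : ContDiff ℝ 1 n := by rw [hn]; exact hF.norm_sq ℝ
  have hq1 : ContDiff ℝ 1 fun y => a y * n y := ha1.mul hn1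
  have hY1 : ContDiff ℝ 1 fun y => (a y * n y) • e₂ := hq1.smul contDiff_const
  have iY : Integrable (fun y => (a y * n y) • e₂) volume := i0.smul_const e₂
  have hdivY : ∀ y, VectorCalculus.divergence (fun z => (a z * n z) • e₂) y =
      deriv h (y 2) * ‖F y‖ ^ 2 + 2 * (h (y 2) * ⟪F y, fderiv ℝ F y e₂⟫) := by
    intro y
    rw [Literature.Analysis.FluidPDE.divergence_smul_apply ((hq1.differentiable one_ne_zero) y) (differentiableAt_const e₂)]
    have hdivconst : VectorCalculus.divergence (fun _ : EuclideanSpace ℝ (Fin 3) => e₂) y = 0 := by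
      rw [divergence_eq_sum_three]; simp
    rw [hdivconst, mul_zero, zero_add, real_inner_comm, gradient, InnerProductSpace.toDual_symm_apply]
    have hm : HasFDerivAt (fun z => a z * n z) (a y • (2 • (innerSL ℝ (F y)).comp (fderiv ℝ F y)) +
        n y • (deriv h (y 2) • (EuclideanSpace.proj (2 : Fin 3) : EuclideanSpace ℝ (Fin 3) →L[ℝ] ℝ))) y :=
      (haD y).mul (hnD y)
    rw [hm.fderiv]
    show a y * ((2 : ℕ) • ⟪F y, fderiv ℝ F y e₂⟫) + n y * (deriv h (y 2) * e₂ 2) = _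
    have e2 : e₂ 2 = 1 := by rw [he₂]; simp
    rw [e2, mul_one, nsmul_eq_mul]
    simp only [ha, hn]
    push_cast
    ring
  have idiv : Integrable (fun y => VectorCalculus.divergence (fun z => (a z * n z) • e₂) y) volume := by
    have e : (fun y => VectorCalculus.divergence (fun z => (a z * n z) • e₂) y) =
        fun y => deriv h (y 2) * ‖F y‖ ^ 2 + 2 * (h (y 2) * ⟪F y, fderiv ℝ F y e₂⟫) := funext hdivY
    rw [e]; exact i2.add (i1.const_mul 2)
  have h0 := integral_divergence_eq_zero_of_integrable hY1 iY idiv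
  simp_rw [hdivY] at h0
  rw [integral_add i2 (i1.const_mul 2), integral_const_mul] at h0
  linarith

/-! ## 2. The horizontal rule -/

/-- **Horizontal integration by parts**: for a HORIZONTAL field `A ∈ C¹` (`A₂ ≡ 0`), a scalar `f ∈ C¹` and an axial weight
`h ∈ C¹(ℝ)`: `∫ h(x₂)·Df(x)(A x) = −∫ h(x₂)·f(x)·div A(x)`, provided the three densities `h f A`, `h·Df(A)`, `h f div A` are
integrable (divergence theorem for `(h(x₂)f)·A`; the weight is not differentiated because `⟪A, e₂⟫ = 0`). [folklore] -/
theorem integral_axialWeight_fderiv_apply_horizontal_eq (hA : ContDiff ℝ 1 A) (hA2 : ∀ x, A x 2 = 0)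
    (hf : ContDiff ℝ 1 f) (hh : ContDiff ℝ 1 h)
    (i0 : Integrable (fun x => (h (x 2) * f x) • A x) volume)
    (i1 : Integrable (fun x => h (x 2) * fderiv ℝ f x (A x)) volume)
    (i2 : Integrable (fun x => h (x 2) * f x * VectorCalculus.divergence A x) volume) :
    (∫ x, h (x 2) * fderiv ℝ f x (A x)) = -∫ x, h (x 2) * f x * VectorCalculus.divergence A x := by
  have hAd : Differentiable ℝ A := hA.differentiable one_ne_zero
  have hfd : Differentiable ℝ f := hf.differentiable one_ne_zero
  have hhd : Differentiable ℝ h := hh.differentiable one_ne_zero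
  set a : EuclideanSpace ℝ (Fin 3) → ℝ := fun y => h (y 2) with ha
  have haD : ∀ y, HasFDerivAt a (deriv h (y 2) •
      (EuclideanSpace.proj (2 : Fin 3) : EuclideanSpace ℝ (Fin 3) →L[ℝ] ℝ)) y := fun y => hasFDerivAt_comp_coord hhd 2 y
  have ha1 : ContDiff ℝ 1 a := by
    have : a = fun y => h ((EuclideanSpace.proj (2 : Fin 3) : EuclideanSpace ℝ (Fin 3) →L[ℝ] ℝ) y) := rfl
    rw [this]; exact hh.comp (EuclideanSpace.proj (2 : Fin 3) : EuclideanSpace ℝ (Fin 3) →L[ℝ] ℝ).contDiff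
  have hq1 : ContDiff ℝ 1 fun y => a y * f y := ha1.mul hf
  have hY1 : ContDiff ℝ 1 fun y => (a y * f y) • A y := hq1.smul hA
  have hdivY : ∀ y, VectorCalculus.divergence (fun z => (a z * f z) • A z) y =
      h (y 2) * f y * VectorCalculus.divergence A y + h (y 2) * fderiv ℝ f y (A y) := by
    intro y
    rw [Literature.Analysis.FluidPDE.divergence_smul_apply ((hq1.differentiable one_ne_zero) y) (hAd y),
      real_inner_comm, gradient, InnerProductSpace.toDual_symm_apply]
    have hm : HasFDerivAt (fun z => a z * f z) (a y • fderiv ℝ f y +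
        f y • (deriv h (y 2) • (EuclideanSpace.proj (2 : Fin 3) : EuclideanSpace ℝ (Fin 3) →L[ℝ] ℝ))) y :=
      (haD y).mul (hfd y).hasFDerivAt
    rw [hm.fderiv]
    show a y * f y * VectorCalculus.divergence A y + (a y * fderiv ℝ f y (A y) + f y * (deriv h (y 2) * A y 2)) = _
    rw [hA2 y, mul_zero, mul_zero, add_zero]
  have idiv : Integrable (fun y => VectorCalculus.divergence (fun z => (a z * f z) • A z) y) volume := by
    have e : (fun y => VectorCalculus.divergence (fun z => (a z * f z) • A z) y) =
        fun y => h (y 2) * f y * VectorCalculus.divergence A y + h (y 2) * fderiv ℝ f y (A y) := funext hdivY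
    rw [e]; exact i2.add i1
  have h0 := integral_divergence_eq_zero_of_integrable hY1 i0 idiv
  simp_rw [hdivY] at h0
  rw [integral_add i2 i1] at h0
  linarith

/-! ## 3. The boundary pairing of the slide -/

/-- **`∫h(x₂)(⟪V_h,∂₂V_h⟫ − ⟪V_h,∇_hV₂⟫) = −½∫h′(x₂)(‖V‖² − 2V₂²)`** for a divergence-free `V ∈ C¹` with `DV ∈ L²`, `‖V‖ ≤ C_V`,
`‖V‖²` integrable on the slab `{|x₂| ≤ T}`, and an axial weight `h ∈ C¹` with `|h|, |h′| ≤ K` vanishing for `T ≤ |s|`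
(no bound on `V` itself is needed).
(In coordinates `⟪V_h,∂₂V_h⟫ = V₀(DVe₂)₀ + V₁(DVe₂)₁`, `⟪V_h,∇_hV₂⟫ = V₀(DVe₀)₂ + V₁(DVe₁)₂`.) [folklore] -/
theorem integral_slideTail_eq (hV : ContDiff ℝ 1 V) (hdiv : VectorCalculus.IsDivFree V) (hh : ContDiff ℝ 1 h)
    {K T : ℝ} (hhK : ∀ s, |h s| ≤ K) (hh'K : ∀ s, |deriv h s| ≤ K)
    (hhT : ∀ s, T ≤ |s| → h s = 0) (hh'T : ∀ s, T ≤ |s| → deriv h s = 0)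
    (hD : Integrable (fun x => ‖fderiv ℝ V x‖ ^ 2) volume)
    (hslab : Integrable (fun x => {x : EuclideanSpace ℝ (Fin 3) | |x 2| ≤ T}.indicator (fun x => ‖V x‖ ^ 2) x) volume) :
    (∫ x, h (x 2) *
        ((V x 0 * fderiv ℝ V x (EuclideanSpace.single 2 1) 0 + V x 1 * fderiv ℝ V x (EuclideanSpace.single 2 1) 1) -
          (V x 0 * fderiv ℝ V x (EuclideanSpace.single 0 1) 2 + V x 1 * fderiv ℝ V x (EuclideanSpace.single 1 1) 2))) =
      -(1 / 2) * ∫ x, deriv h (x 2) * (‖V x‖ ^ 2 - 2 * (V x 2) ^ 2) := by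
  set e₂ : EuclideanSpace ℝ (Fin 3) := EuclideanSpace.single (2 : Fin 3) (1 : ℝ) with he₂
  set SL : Set (EuclideanSpace ℝ (Fin 3)) := {x | |x 2| ≤ T} with hSL
  have hVd : Differentiable ℝ V := hV.differentiable one_ne_zero
  have hK0 : 0 ≤ K := (abs_nonneg _).trans (hhK 0)
  have cV : Continuous V := hV.continuous
  have cDV : Continuous (fderiv ℝ V) := hV.continuous_fderiv one_ne_zero
  have ch : Continuous fun x : EuclideanSpace ℝ (Fin 3) => h (x 2) := hh.continuous.comp (PiLp.continuous_apply 2 _ (2 : Fin 3))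
  have ch' : Continuous fun x : EuclideanSpace ℝ (Fin 3) => deriv h (x 2) :=
    (hh.continuous_deriv le_rfl).comp (PiLp.continuous_apply 2 _ (2 : Fin 3))
  -- coordinates are bounded by norms
  have hcoordV : ∀ x (i : Fin 3), |V x i| ≤ ‖V x‖ := fun x i => by
    have := PiLp.norm_apply_le (p := 2) (V x) i; rwa [Real.norm_eq_abs] at this
  have hne : ∀ j : Fin 3, ‖(EuclideanSpace.single j (1 : ℝ) : EuclideanSpace ℝ (Fin 3))‖ = 1 := fun j => by
    rw [PiLp.norm_single, norm_one]
  have hcoordD : ∀ x (i j : Fin 3), |fderiv ℝ V x (EuclideanSpace.single j 1) i| ≤ ‖fderiv ℝ V x‖ := fun x i j => by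
    have h1 := PiLp.norm_apply_le (p := 2) (fderiv ℝ V x (EuclideanSpace.single j 1)) i
    rw [Real.norm_eq_abs] at h1
    refine h1.trans ?_
    calc ‖fderiv ℝ V x (EuclideanSpace.single j 1)‖ ≤ ‖fderiv ℝ V x‖ * ‖(EuclideanSpace.single j (1 : ℝ) : EuclideanSpace ℝ (Fin 3))‖ :=
          (fderiv ℝ V x).le_opNorm _
      _ = ‖fderiv ℝ V x‖ := by rw [hne, mul_one]
  -- the dominating function `K(1_{slab}‖V‖² + ‖DV‖²)` for the weighted `V·DV` products
  set G : EuclideanSpace ℝ (Fin 3) → ℝ := fun x => K * (SL.indicator (fun x => ‖V x‖ ^ 2) x + ‖fderiv ℝ V x‖ ^ 2) with hG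
  have iG : Integrable G volume := (hslab.add hD).const_mul K
  have hslab_ind : ∀ x, h (x 2) ≠ 0 → SL.indicator (fun x => ‖V x‖ ^ 2) x = ‖V x‖ ^ 2 := by
    intro x hx
    have hxT : |x 2| ≤ T := by by_contra hc; exact hx (hhT _ (not_le.1 hc).le)
    rw [indicator_of_mem (show x ∈ SL from hxT)]
  have hslab_ind' : ∀ x, deriv h (x 2) ≠ 0 → SL.indicator (fun x => ‖V x‖ ^ 2) x = ‖V x‖ ^ 2 := by
    intro x hx
    have hxT : |x 2| ≤ T := by by_contra hc; exact hx (hh'T _ (not_le.1 hc).le)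
    rw [indicator_of_mem (show x ∈ SL from hxT)]
  -- generic domination: `|w(x₂)| ≤ K`, `w = 0` off the slab ⇒ `|w·V_i·(DV)_{..}| ≤ G/1`
  have dom : ∀ (w : ℝ → ℝ), (∀ s, |w s| ≤ K) → (∀ x : EuclideanSpace ℝ (Fin 3), w (x 2) ≠ 0 →
      SL.indicator (fun x => ‖V x‖ ^ 2) x = ‖V x‖ ^ 2) →
      ∀ x (i i' j : Fin 3), |w (x 2) * (V x i * fderiv ℝ V x (EuclideanSpace.single j 1) i')| ≤ G x := by
    intro w hw hwind x i i' j
    by_cases hx : w (x 2) = 0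
    · rw [hx, zero_mul, abs_zero]; exact mul_nonneg hK0 (add_nonneg (indicator_nonneg (fun _ _ => sq_nonneg _) _) (sq_nonneg _))
    rw [hG]; dsimp only; rw [hwind x hx, abs_mul, abs_mul]
    have h1 : |V x i| * |fderiv ℝ V x (EuclideanSpace.single j 1) i'| ≤ ‖V x‖ * ‖fderiv ℝ V x‖ :=
      mul_le_mul (hcoordV x i) (hcoordD x i' j) (abs_nonneg _) (norm_nonneg _)
    have h2 : ‖V x‖ * ‖fderiv ℝ V x‖ ≤ ‖V x‖ ^ 2 + ‖fderiv ℝ V x‖ ^ 2 := by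
      nlinarith [sq_nonneg (‖V x‖ - ‖fderiv ℝ V x‖), norm_nonneg (V x), norm_nonneg (fderiv ℝ V x)]
    calc |w (x 2)| * (|V x i| * |fderiv ℝ V x (EuclideanSpace.single j 1) i'|) ≤ K * (‖V x‖ * ‖fderiv ℝ V x‖) :=
          mul_le_mul (hw _) h1 (by positivity) hK0
      _ ≤ K * (‖V x‖ ^ 2 + ‖fderiv ℝ V x‖ ^ 2) := mul_le_mul_of_nonneg_left h2 hK0
  have meas : ∀ (w : ℝ → ℝ), Continuous w → ∀ (i i' j : Fin 3),
      AEStronglyMeasurable (fun x : EuclideanSpace ℝ (Fin 3) => w (x 2) * (V x i * fderiv ℝ V x (EuclideanSpace.single j 1) i')) volume := by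
    intro w hw i i' j
    refine ((hw.comp (PiLp.continuous_apply 2 _ (2 : Fin 3))).mul
      (((PiLp.continuous_apply 2 _ i).comp cV).mul
        ((PiLp.continuous_apply 2 _ i').comp (cDV.clm_apply continuous_const)))).aestronglyMeasurable
  have intVD : ∀ (i i' j : Fin 3),
      Integrable (fun x => h (x 2) * (V x i * fderiv ℝ V x (EuclideanSpace.single j 1) i')) volume := fun i i' j =>
    iG.mono' (meas h hh.continuous i i' j) (Eventually.of_forall fun x => by
      rw [Real.norm_eq_abs]; exact dom h hhK hslab_ind x i i' j)
  -- (a) the axial pairing `∫h⟪V_h,∂₂V_h⟫ = −½∫h′‖V_h‖²` with `F = V − V₂e₂`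
  set Fh : EuclideanSpace ℝ (Fin 3) → EuclideanSpace ℝ (Fin 3) := fun y => V y - (V y 2) • e₂ with hFh
  have hV2c : ContDiff ℝ 1 fun y => V y 2 := contDiff_apply_coord_vec3 hV 2
  have hFh1 : ContDiff ℝ 1 Fh := hV.sub (hV2c.smul contDiff_const)
  have hV2D : ∀ y, HasFDerivAt (fun z => V z 2)
      ((EuclideanSpace.proj (2 : Fin 3) : EuclideanSpace ℝ (Fin 3) →L[ℝ] ℝ).comp (fderiv ℝ V y)) y :=
    fun y => (EuclideanSpace.proj (2 : Fin 3) : EuclideanSpace ℝ (Fin 3) →L[ℝ] ℝ).hasFDerivAt.comp y (hVd y).hasFDerivAt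
  have hDFh : ∀ y, fderiv ℝ Fh y e₂ = fderiv ℝ V y e₂ - (fderiv ℝ V y e₂ 2) • e₂ := by
    intro y
    have h1 : HasFDerivAt (fun z => (V z 2) • e₂)
        ((((EuclideanSpace.proj (2 : Fin 3) : EuclideanSpace ℝ (Fin 3) →L[ℝ] ℝ).comp (fderiv ℝ V y)).smulRight e₂)) y :=
      (hV2D y).smul_const e₂
    have h2 : HasFDerivAt Fh (fderiv ℝ V y -
        (((EuclideanSpace.proj (2 : Fin 3) : EuclideanSpace ℝ (Fin 3) →L[ℝ] ℝ).comp (fderiv ℝ V y)).smulRight e₂)) y :=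
      (hVd y).hasFDerivAt.sub h1
    rw [h2.fderiv]; rfl
  have hFh_sq : ∀ y, ‖Fh y‖ ^ 2 = ‖V y‖ ^ 2 - (V y 2) ^ 2 := by
    intro y
    rw [EuclideanSpace.real_norm_sq_eq, EuclideanSpace.real_norm_sq_eq, Fin.sum_univ_three, Fin.sum_univ_three]
    simp [hFh, he₂]
  have hFh_inner : ∀ y, ⟪Fh y, fderiv ℝ Fh y e₂⟫ = V y 0 * fderiv ℝ V y e₂ 0 + V y 1 * fderiv ℝ V y e₂ 1 := by
    intro y
    rw [hDFh]
    simp [hFh, he₂, PiLp.inner_apply, Fin.sum_univ_three]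
    ring
  have ia0 : Integrable (fun x => h (x 2) * ‖Fh x‖ ^ 2) volume := by
    refine (hslab.const_mul K).mono' (ch.mul (hFh1.continuous.norm.pow 2)).aestronglyMeasurable
      (Eventually.of_forall fun x => ?_)
    rw [Real.norm_eq_abs, abs_mul, abs_of_nonneg (sq_nonneg ‖Fh x‖), hFh_sq]
    by_cases hx : h (x 2) = 0
    · rw [hx, abs_zero, zero_mul]; exact mul_nonneg hK0 (indicator_nonneg (fun _ _ => sq_nonneg _) _)
    rw [hslab_ind x hx]
    have hv2 : (V x 2) ^ 2 ≤ ‖V x‖ ^ 2 := by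
      rw [← sq_abs]; exact pow_le_pow_left₀ (abs_nonneg _) (hcoordV x 2) 2
    exact mul_le_mul (hhK _) (by nlinarith [sq_nonneg (V x 2)]) (by linarith) hK0
  have ia1 : Integrable (fun x => h (x 2) * ⟪Fh x, fderiv ℝ Fh x e₂⟫) volume := by
    have e : (fun x => h (x 2) * ⟪Fh x, fderiv ℝ Fh x e₂⟫) =
        fun x => h (x 2) * (V x 0 * fderiv ℝ V x e₂ 0) + h (x 2) * (V x 1 * fderiv ℝ V x e₂ 1) := by
      funext x; rw [hFh_inner]; ring
    rw [e]; exact (intVD 0 0 2).add (intVD 1 1 2)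
  have ia2 : Integrable (fun x => deriv h (x 2) * ‖Fh x‖ ^ 2) volume := by
    refine (hslab.const_mul K).mono' (ch'.mul (hFh1.continuous.norm.pow 2)).aestronglyMeasurable
      (Eventually.of_forall fun x => ?_)
    rw [Real.norm_eq_abs, abs_mul, abs_of_nonneg (sq_nonneg ‖Fh x‖), hFh_sq]
    by_cases hx : deriv h (x 2) = 0
    · rw [hx, abs_zero, zero_mul]; exact mul_nonneg hK0 (indicator_nonneg (fun _ _ => sq_nonneg _) _)
    rw [hslab_ind' x hx]
    have hv2 : (V x 2) ^ 2 ≤ ‖V x‖ ^ 2 := by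
      rw [← sq_abs]; exact pow_le_pow_left₀ (abs_nonneg _) (hcoordV x 2) 2
    exact mul_le_mul (hh'K _) (by nlinarith [sq_nonneg (V x 2)]) (by linarith) hK0
  have hA := integral_axialWeight_inner_fderiv_eq_of_integrable hFh1 hh ia0 ia1 ia2
  rw [← he₂] at hA
  simp_rw [hFh_inner, hFh_sq] at hA
  -- (b) the horizontal pairing `∫h⟪V_h,∇_hV₂⟫ = −∫h V₂ div V_h = ∫h V₂ ∂₂V₂`
  have hFh2 : ∀ x, Fh x 2 = 0 := fun x => by
    show (V x - (V x 2) • e₂) 2 = 0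
    rw [he₂]; simp
  have hdivFh : ∀ x, VectorCalculus.divergence Fh x = -(fderiv ℝ V x e₂ 2) := by
    intro x
    have hsplit : Fh = fun y => V y + (-1 : ℝ) • ((V y 2) • e₂) := by
      funext y; simp only [hFh, neg_one_smul]; abel
    have hd2 : Differentiable ℝ fun y => (V y 2) • e₂ := fun y => ((hV2D y).smul_const e₂).differentiableAt
    rw [hsplit, divergence_add_smul hVd hd2, hdiv x, zero_add,
      Literature.Analysis.FluidPDE.divergence_smul_apply (hV2D x).differentiableAt (differentiableAt_const e₂)]
    have hdivconst : VectorCalculus.divergence (fun _ : EuclideanSpace ℝ (Fin 3) => e₂) x = 0 := by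
      rw [divergence_eq_sum_three]; simp
    rw [hdivconst, mul_zero, zero_add, real_inner_comm, gradient, InnerProductSpace.toDual_symm_apply, (hV2D x).fderiv]
    show -1 * (fderiv ℝ V x e₂ 2) = _
    ring
  have hDf : ∀ x, fderiv ℝ (fun z => V z 2) x (Fh x) =
      V x 0 * fderiv ℝ V x (EuclideanSpace.single 0 1) 2 + V x 1 * fderiv ℝ V x (EuclideanSpace.single 1 1) 2 := by
    intro x
    rw [(hV2D x).fderiv]
    show (fderiv ℝ V x (Fh x)) 2 = _
    have hdec : Fh x = (V x 0) • EuclideanSpace.single (0 : Fin 3) (1 : ℝ) + (V x 1) • EuclideanSpace.single (1 : Fin 3) (1 : ℝ) := by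
      ext i; fin_cases i <;> simp [hFh, he₂]
    rw [hdec, map_add, map_smul, map_smul, PiLp.add_apply, PiLp.smul_apply, PiLp.smul_apply, smul_eq_mul, smul_eq_mul]
  have ib0 : Integrable (fun x => (h (x 2) * V x 2) • Fh x) volume := by
    refine (hslab.const_mul K).mono' ((ch.mul ((PiLp.continuous_apply 2 _ (2 : Fin 3)).comp cV)).smul
      hFh1.continuous).aestronglyMeasurable (Eventually.of_forall fun x => ?_)
    by_cases hx : h (x 2) = 0
    · rw [hx, zero_mul, zero_smul, norm_zero]
      exact mul_nonneg hK0 (indicator_nonneg (fun _ _ => sq_nonneg _) _)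
    rw [hslab_ind x hx, norm_smul, Real.norm_eq_abs, abs_mul]
    have hF : ‖Fh x‖ ≤ ‖V x‖ := by
      have h1 := hFh_sq x
      nlinarith [sq_nonneg (V x 2), norm_nonneg (Fh x), norm_nonneg (V x)]
    have s1 : |h (x 2)| * |V x 2| ≤ K * ‖V x‖ := mul_le_mul (hhK _) (hcoordV x 2) (abs_nonneg _) hK0
    calc |h (x 2)| * |V x 2| * ‖Fh x‖ ≤ K * ‖V x‖ * ‖V x‖ :=
          mul_le_mul s1 hF (norm_nonneg _) (mul_nonneg hK0 (norm_nonneg _))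
      _ = K * ‖V x‖ ^ 2 := by ring
  have ib1 : Integrable (fun x => h (x 2) * fderiv ℝ (fun z => V z 2) x (Fh x)) volume := by
    have e : (fun x => h (x 2) * fderiv ℝ (fun z => V z 2) x (Fh x)) =
        fun x => h (x 2) * (V x 0 * fderiv ℝ V x (EuclideanSpace.single 0 1) 2) +
          h (x 2) * (V x 1 * fderiv ℝ V x (EuclideanSpace.single 1 1) 2) := by
      funext x; rw [hDf]; ring
    rw [e]; exact (intVD 0 2 0).add (intVD 1 2 1)
  have ib2 : Integrable (fun x => h (x 2) * V x 2 * VectorCalculus.divergence Fh x) volume := by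
    have e : (fun x => h (x 2) * V x 2 * VectorCalculus.divergence Fh x) =
        fun x => (-1) * (h (x 2) * (V x 2 * fderiv ℝ V x (EuclideanSpace.single 2 1) 2)) := by
      funext x; rw [hdivFh]; ring
    rw [e]; exact (intVD 2 2 2).const_mul (-1)
  have hB := integral_axialWeight_fderiv_apply_horizontal_eq hFh1 hFh2 hV2c hh ib0 ib1 ib2
  simp_rw [hDf, hdivFh] at hB
  -- (c) `∫h V₂ ∂₂V₂ = −½∫h′ V₂²` (axial rule with `F = V₂ e₂`)
  set F2 : EuclideanSpace ℝ (Fin 3) → EuclideanSpace ℝ (Fin 3) := fun y => (V y 2) • e₂ with hF2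
  have hF21 : ContDiff ℝ 1 F2 := hV2c.smul contDiff_const
  have hF2_sq : ∀ y, ‖F2 y‖ ^ 2 = (V y 2) ^ 2 := by
    intro y
    rw [hF2, norm_smul, mul_pow, hne 2, one_pow, mul_one, Real.norm_eq_abs, sq_abs]
  have hF2_inner : ∀ y, ⟪F2 y, fderiv ℝ F2 y e₂⟫ = V y 2 * fderiv ℝ V y e₂ 2 := by
    intro y
    have h1 : HasFDerivAt F2
        ((((EuclideanSpace.proj (2 : Fin 3) : EuclideanSpace ℝ (Fin 3) →L[ℝ] ℝ).comp (fderiv ℝ V y)).smulRight e₂)) y :=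
      (hV2D y).smul_const e₂
    rw [h1.fderiv]
    show ⟪(V y 2) • e₂, (fderiv ℝ V y e₂ 2) • e₂⟫ = _
    rw [real_inner_smul_left, real_inner_smul_right, real_inner_self_eq_norm_sq, hne 2]
    ring
  have ic0 : Integrable (fun x => h (x 2) * ‖F2 x‖ ^ 2) volume := by
    refine (hslab.const_mul K).mono' (ch.mul (hF21.continuous.norm.pow 2)).aestronglyMeasurable
      (Eventually.of_forall fun x => ?_)
    rw [Real.norm_eq_abs, abs_mul, abs_of_nonneg (sq_nonneg ‖F2 x‖), hF2_sq]
    by_cases hx : h (x 2) = 0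
    · rw [hx, abs_zero, zero_mul]; exact mul_nonneg hK0 (indicator_nonneg (fun _ _ => sq_nonneg _) _)
    rw [hslab_ind x hx]
    exact mul_le_mul (hhK _) (by nlinarith [sq_abs (V x 2), hcoordV x 2, abs_nonneg (V x 2)]) (sq_nonneg _) hK0
  have ic1 : Integrable (fun x => h (x 2) * ⟪F2 x, fderiv ℝ F2 x e₂⟫) volume := by
    have e : (fun x => h (x 2) * ⟪F2 x, fderiv ℝ F2 x e₂⟫) =
        fun x => h (x 2) * (V x 2 * fderiv ℝ V x e₂ 2) := by funext x; rw [hF2_inner]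
    rw [e]; exact intVD 2 2 2
  have ic2 : Integrable (fun x => deriv h (x 2) * ‖F2 x‖ ^ 2) volume := by
    refine (hslab.const_mul K).mono' (ch'.mul (hF21.continuous.norm.pow 2)).aestronglyMeasurable
      (Eventually.of_forall fun x => ?_)
    rw [Real.norm_eq_abs, abs_mul, abs_of_nonneg (sq_nonneg ‖F2 x‖), hF2_sq]
    by_cases hx : deriv h (x 2) = 0
    · rw [hx, abs_zero, zero_mul]; exact mul_nonneg hK0 (indicator_nonneg (fun _ _ => sq_nonneg _) _)
    rw [hslab_ind' x hx]
    exact mul_le_mul (hh'K _) (by nlinarith [sq_abs (V x 2), hcoordV x 2, abs_nonneg (V x 2)]) (sq_nonneg _) hK0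
  have hC := integral_axialWeight_inner_fderiv_eq_of_integrable hF21 hh ic0 ic1 ic2
  rw [← he₂] at hC
  simp_rw [hF2_inner, hF2_sq] at hC
  -- assemble
  have iA : Integrable (fun x => h (x 2) *
      (V x 0 * fderiv ℝ V x e₂ 0 + V x 1 * fderiv ℝ V x e₂ 1)) volume := by
    have e : (fun x => h (x 2) * (V x 0 * fderiv ℝ V x e₂ 0 + V x 1 * fderiv ℝ V x e₂ 1)) =
        fun x => h (x 2) * (V x 0 * fderiv ℝ V x e₂ 0) + h (x 2) * (V x 1 * fderiv ℝ V x e₂ 1) := by funext x; ring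
    rw [e]; exact (intVD 0 0 2).add (intVD 1 1 2)
  have iB : Integrable (fun x => h (x 2) *
      (V x 0 * fderiv ℝ V x (EuclideanSpace.single 0 1) 2 + V x 1 * fderiv ℝ V x (EuclideanSpace.single 1 1) 2)) volume := by
    have e : (fun x => h (x 2) *
        (V x 0 * fderiv ℝ V x (EuclideanSpace.single 0 1) 2 + V x 1 * fderiv ℝ V x (EuclideanSpace.single 1 1) 2)) =
        fun x => h (x 2) * (V x 0 * fderiv ℝ V x (EuclideanSpace.single 0 1) 2) +
          h (x 2) * (V x 1 * fderiv ℝ V x (EuclideanSpace.single 1 1) 2) := by funext x; ring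
    rw [e]; exact (intVD 0 2 0).add (intVD 1 2 1)
  have iV2 : Integrable (fun x => deriv h (x 2) * (V x 2) ^ 2) volume := by
    have e : (fun x => deriv h (x 2) * (V x 2) ^ 2) = fun x => deriv h (x 2) * ‖F2 x‖ ^ 2 := by
      funext x; rw [hF2_sq]
    rw [e]; exact ic2
  have iVV : Integrable (fun x => deriv h (x 2) * (‖V x‖ ^ 2 - (V x 2) ^ 2)) volume := by
    have e : (fun x => deriv h (x 2) * (‖V x‖ ^ 2 - (V x 2) ^ 2)) = fun x => deriv h (x 2) * ‖Fh x‖ ^ 2 := by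
      funext x; rw [hFh_sq]
    rw [e]; exact ia2
  have hsplit : (∫ x, h (x 2) *
      ((V x 0 * fderiv ℝ V x e₂ 0 + V x 1 * fderiv ℝ V x e₂ 1) -
        (V x 0 * fderiv ℝ V x (EuclideanSpace.single 0 1) 2 + V x 1 * fderiv ℝ V x (EuclideanSpace.single 1 1) 2))) =
      (∫ x, h (x 2) * (V x 0 * fderiv ℝ V x e₂ 0 + V x 1 * fderiv ℝ V x e₂ 1)) -
        ∫ x, h (x 2) * (V x 0 * fderiv ℝ V x (EuclideanSpace.single 0 1) 2 + V x 1 * fderiv ℝ V x (EuclideanSpace.single 1 1) 2) := by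
    rw [← integral_sub iA iB]
    refine integral_congr_ae (Eventually.of_forall fun x => ?_)
    ring
  have hrhs : (∫ x, deriv h (x 2) * (‖V x‖ ^ 2 - 2 * (V x 2) ^ 2)) =
      (∫ x, deriv h (x 2) * (‖V x‖ ^ 2 - (V x 2) ^ 2)) - ∫ x, deriv h (x 2) * (V x 2) ^ 2 := by
    rw [← integral_sub iVV iV2]
    refine integral_congr_ae (Eventually.of_forall fun x => ?_)
    ring
  have hB' : (∫ x, h (x 2) *
      (V x 0 * fderiv ℝ V x (EuclideanSpace.single 0 1) 2 + V x 1 * fderiv ℝ V x (EuclideanSpace.single 1 1) 2)) =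
      ∫ x, h (x 2) * (V x 2 * fderiv ℝ V x e₂ 2) := by
    rw [hB, ← integral_neg]
    refine integral_congr_ae (Eventually.of_forall fun x => ?_)
    ring
  rw [hsplit, hrhs, hA, hB', hC]
  ring

end ExtremiserLiouville

end Summit.NavierStokesRegularity.NavierStokesRegularity.Theorems

end
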